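import Mathlib
import HarnessLib
import Summits.Ventures.LatticeQCDFlow.Exactness.NCMCGeneralSpaceEstimatorBias
import Summits.Ventures.LatticeQCDFlow.Exactness.NCMCGeneralSpaceEstimatorConsistency

/-!
# Finite-`N` guarantees for the engine's estimators on a general state space: Chebyshev through `1/ESS_F − 1`

HONEST FRAMING: exact (Metropolis-corrected) sampling algorithms for lattice gauge theory;
figures of merit are autocorrelation/cost numbers at stated couplings and volumes; no
continuum-physics claim.

Venture `LatticeQCDFlow` (cell pub-lqcd), topic `Exactness`; FANOUT row 13 (`eng-snf`, GEN-12).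
NEW WORK of the cell (elementary probability on product laws: Mathlib's Chebyshev inequality
`ProbabilityTheory.meas_ge_le_variance_div_sq`), not a published result; nothing is cited as a
fact.  Companion of `NCMCGeneralSpaceEstimatorCLT.lean` (the ASYMPTOTIC law `√n(ΔF̂_n − ΔF) →d
N(0, 1/ESS_F − 1)`), which claims no finite-`N` coverage: THIS file gives the non-asymptotic,
distribution-free statement that holds at every `N`, in the same currency `1/ESS_F − 1`
(`NCMCGeneralSpaceEstimatorConsistency.variance_sampleMean_exp_neg_work`: the `N`-evolution
exponential average has relative variance `(1/ESS_F − 1)/N`).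

## Setting and content

`μ` a probability law on records `E`, `N ≥ 1` i.i.d. records under `Measure.pi (fun _ : Fin N => μ)`,
`Ȳ_N = sampleMean w`, `ΔF̂_N = jarzynskiEstimate w = −log Ȳ_N` (`JarzynskiEstimatorBias.lean`).

* `memLp_sampleMean_pi`; **`measure_sampleMean_sub_ge_le`** — CHEBYSHEV FOR THE SAMPLE MEAN:
  `μ^{⊗N} {|Ȳ_N − E_μ w| ≥ c} ≤ Var_μ[w] / (N c²)` (`w ∈ L²(μ)`, `c > 0`).
* For a Crooks pair `(κF, κR, s, e, W)` from `ν₀` to `ν₁` with `e^{−W} ∈ L²(P_F)`, `N ≥ 1`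
  independent forward evolutions (law `Measure.pi (fun _ => P_F)`), `e^{−ΔF} = Z₁/Z₀`:
  **`CrooksPair.measure_sampleMean_exp_neg_work_ge_le`** — RELATIVE ERROR OF THE EXPONENTIAL
  AVERAGE: `P {|Ȳ_N − e^{−ΔF}| ≥ ε e^{−ΔF}} ≤ (1/ESS_F − 1)/(N ε²)` for every `ε > 0`, the numerator
  written `E_F e^{−2W}/(E_F e^{−W})² − 1`;
  `abs_neg_log_add_log_lt` — on `|Ȳ − θ| < εθ` (`0 < ε < 1`) one has `|ΔF̂ − (−log θ)| < −log(1 − ε)`;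
  **`CrooksPair.measure_jarzynskiEstimate_sub_ge_le`** — CHEBYSHEV FOR `ΔF̂`:
  `P {|ΔF̂_N − ΔF| ≥ −log(1 − ε)} ≤ (1/ESS_F − 1)/(N ε²)` for `0 < ε < 1`, and
  **`CrooksPair.measure_jarzynskiEstimate_sub_ge_le_dissipation`** — the same with the numerator
  written `E_F[e^{−2(W−ΔF)}] − 1` (`= 1/ESS_F − 1`, `NCMCGeneralSpaceDissipation.essPop_eq_inv_dissipation`);
  `CrooksPair.measure_jarzynskiEstimate_sub_ge_le_of_le` — the sample-size rule: if
  `(E_F[e^{−2(W−ΔF)}] − 1)/(N ε²) ≤ δ` then that probability is at most `δ`.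
  Reading for the engine: with `N` independent evolutions and population Kish fraction `ESS_F`,
  `dF` misses `ΔF` by more than `log 2` (`ε = ½`) with probability at most `4(1/ESS_F − 1)/N`,
  whatever the work law — an audit inequality a reported `(N, ess, dF ± err)` triple can be held to.

Scope / NOT CLAIMED: independent evolutions only; `ESS_F` is the POPULATION quantity (the reported
`ess/N` is its consistent estimate, `NCMCGeneralSpaceEstimatorConsistency.tendsto_essHat_ae`, not a
bound on it); Chebyshev is loose — the CLT file gives the sharp asymptotic scale.
-/

namespace Summit.Ventures.LatticeQCDFlow.Exactness.GeneralNCMC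

open MeasureTheory ProbabilityTheory Set Filter Finset
open scoped ENNReal Topology

variable {E : Type*} [MeasurableSpace E]

/-! ## Chebyshev for the sample mean of `N` i.i.d. records -/

/-- The sample mean of `N` i.i.d. records of an `L²(μ)` weight is in `L²` of the product law. -/
theorem memLp_sampleMean_pi (μ : Measure E) [IsProbabilityMeasure μ] {w : E → ℝ}
    (hw : MemLp w 2 μ) (N : ℕ) :
    MemLp (fun y : Fin N → E => sampleMean w y) 2 (Measure.pi fun _ : Fin N => μ) := by
  have hfun : (fun y : Fin N → E => sampleMean w y) =
      fun y => (N : ℝ)⁻¹ * ∑ i : Fin N, w (y i) := by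
    funext y
    unfold sampleMean
    rw [div_eq_inv_mul]
  rw [hfun]
  refine MemLp.const_mul ?_ _
  refine memLp_finsetSum (ε' := ℝ) _ (f := fun (i : Fin N) (y : Fin N → E) => w (y i))
    fun i _ => ?_
  exact hw.comp_measurePreserving (measurePreserving_eval (fun _ : Fin N => μ) i)

/-- **Chebyshev for the sample mean**: for `w ∈ L²(μ)`, `N ≥ 1` and `c > 0`,
`μ^{⊗N} {|(1/N) Σ_i w(y i) − E_μ w| ≥ c} ≤ Var_μ[w] / (N c²)`. -/
theorem measure_sampleMean_sub_ge_le (μ : Measure E) [IsProbabilityMeasure μ] {w : E → ℝ}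
    (hw : MemLp w 2 μ) {N : ℕ} (hN : 0 < N) {c : ℝ} (hc : 0 < c) :
    (Measure.pi fun _ : Fin N => μ) {y | c ≤ |sampleMean w y - ∫ a, w a ∂μ|} ≤
      ENNReal.ofReal (Var[w; μ] / (N * c ^ 2)) := by
  have hcheb := meas_ge_le_variance_div_sq (memLp_sampleMean_pi μ hw N) hc
  rw [integral_sampleMean_pi μ (hw.integrable one_le_two) hN, variance_sampleMean_pi μ hw hN,
    div_div] at hcheb
  exact hcheb

/-! ## For a Crooks pair: relative error of the exponential average, absolute error of `ΔF̂` -/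

namespace CrooksPair

variable {Ω : Type*} [MeasurableSpace Ω]
variable {ν₀ ν₁ : Measure Ω} {κF κR : Kernel Ω E} {s e : E → Ω} {W : E → ℝ}

/-- **Chebyshev for the exponential average of a Crooks pair.**  For `N ≥ 1` independent forward
evolutions with `e^{−W} ∈ L²(P_F)` and every `ε > 0`:
`P_F^{⊗N} {|(1/N) Σ_i e^{−W_i} − Z₁/Z₀| ≥ ε · Z₁/Z₀} ≤ (E_F e^{−2W}/(E_F e^{−W})² − 1) / (N ε²)`,
the numerator being `1/ESS_F − 1`. -/
theorem measure_sampleMean_exp_neg_work_ge_le [IsFiniteMeasure ν₀] [IsFiniteMeasure ν₁]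
    [IsMarkovKernel κF] [IsMarkovKernel κR] (h0 : ν₀ univ ≠ 0) (h1 : ν₁ univ ≠ 0)
    (h : CrooksPair ν₀ ν₁ κF κR s e W)
    (hL2 : MemLp (fun ε => Real.exp (-W ε)) 2 (fwdPathLaw ν₀ κF)) {N : ℕ} (hN : 0 < N) {ε : ℝ}
    (hε : 0 < ε) :
    haveI := isProbabilityMeasure_fwdPathLaw ν₀ h0 κF
    (Measure.pi fun _ : Fin N => fwdPathLaw ν₀ κF)
        {y | ε * ((ν₀ univ)⁻¹ * ν₁ univ).toReal ≤
          |sampleMean (fun ε => Real.exp (-W ε)) y - ((ν₀ univ)⁻¹ * ν₁ univ).toReal|} ≤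
      ENNReal.ofReal (((∫ ε, Real.exp (-(2 * W ε)) ∂(fwdPathLaw ν₀ κF)) /
          (∫ ε, Real.exp (-W ε) ∂(fwdPathLaw ν₀ κF)) ^ 2 - 1) / (N * ε ^ 2)) := by
  haveI := isProbabilityMeasure_fwdPathLaw ν₀ h0 κF
  have hr := toReal_ratio_pos (ν₀ := ν₀) (ν₁ := ν₁) h0 h1
  have hc : 0 < ε * ((ν₀ univ)⁻¹ * ν₁ univ).toReal := mul_pos hε hr
  have hcheb := measure_sampleMean_sub_ge_le (fwdPathLaw ν₀ κF) hL2 hN hc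
  rw [h.integral_exp_neg_work] at hcheb
  refine hcheb.trans (le_of_eq ?_)
  congr 1
  rw [← h.variance_exp_neg_work_div_sq h0 h1 hL2, h.integral_exp_neg_work]
  field_simp

/-- On the event `|Ȳ − θ| < ε θ` (`0 < ε < 1`, `θ > 0`) the free-energy estimate is within
`log (1/(1 − ε))` of `−log θ`: `|−log Ȳ + log θ| < −log (1 − ε)`. -/
theorem abs_neg_log_add_log_lt {θ Y ε : ℝ} (hθ : 0 < θ) (hε : 0 < ε) (hε1 : ε < 1)
    (hY : |Y - θ| < ε * θ) : |-Real.log Y - -Real.log θ| < -Real.log (1 - ε) := by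
  rw [abs_lt] at hY
  have hε0 : 0 < 1 - ε := by linarith
  have h1e : 0 < 1 + ε := by linarith
  have hlo : (1 - ε) * θ < Y := by linarith
  have hhi : Y < (1 + ε) * θ := by linarith
  have hYpos : 0 < Y := lt_trans (mul_pos hε0 hθ) hlo
  have hform : -Real.log Y - -Real.log θ = Real.log (θ / Y) := by
    rw [Real.log_div hθ.ne' hYpos.ne']
    ring
  rw [hform, abs_lt]
  constructor
  · -- `log (1 − ε) ≤ −log (1 + ε) < log (θ/Y)`
    have h1 : Real.log (1 - ε) ≤ -Real.log (1 + ε) := by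
      rw [← Real.log_inv]
      refine Real.log_le_log hε0 ?_
      rw [inv_eq_one_div, le_div_iff₀ h1e]
      nlinarith
    have h2 : -Real.log (1 + ε) < Real.log (θ / Y) := by
      rw [← Real.log_inv]
      refine Real.log_lt_log (inv_pos.2 h1e) ?_
      rw [inv_eq_one_div, div_lt_div_iff₀ h1e hYpos]
      linarith
    linarith
  · -- `log (θ/Y) < log (1/(1 − ε)) = −log (1 − ε)`
    rw [← Real.log_inv]
    refine Real.log_lt_log (div_pos hθ hYpos) ?_
    rw [inv_eq_one_div, div_lt_div_iff₀ hYpos hε0]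
    linarith

/-- **Chebyshev for `ΔF̂`.**  For `N ≥ 1` independent forward evolutions with `e^{−W} ∈ L²(P_F)`,
`e^{−ΔF} = Z₁/Z₀` and `0 < ε < 1`:
`P_F^{⊗N} {|ΔF̂_N − ΔF| ≥ −log(1 − ε)} ≤ (1/ESS_F − 1) / (N ε²)` — a NON-ASYMPTOTIC coverage statement
for the engine's `dF` in terms of its own `ess` diagnostic (e.g. `ε = ½`: missing `ΔF` by more than
`log 2` has probability at most `4(1/ESS_F − 1)/N`). -/
theorem measure_jarzynskiEstimate_sub_ge_le [IsFiniteMeasure ν₀] [IsFiniteMeasure ν₁]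
    [IsMarkovKernel κF] [IsMarkovKernel κR] (h0 : ν₀ univ ≠ 0) (h1 : ν₁ univ ≠ 0)
    (h : CrooksPair ν₀ ν₁ κF κR s e W)
    (hL2 : MemLp (fun ε => Real.exp (-W ε)) 2 (fwdPathLaw ν₀ κF)) {ΔF : ℝ}
    (hΔF : Real.exp (-ΔF) = ((ν₀ univ)⁻¹ * ν₁ univ).toReal) {N : ℕ} (hN : 0 < N) {ε : ℝ}
    (hε : 0 < ε) (hε1 : ε < 1) :
    haveI := isProbabilityMeasure_fwdPathLaw ν₀ h0 κF
    (Measure.pi fun _ : Fin N => fwdPathLaw ν₀ κF)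
        {y | -Real.log (1 - ε) ≤ |jarzynskiEstimate (fun ε => Real.exp (-W ε)) y - ΔF|} ≤
      ENNReal.ofReal (((∫ ε, Real.exp (-(2 * W ε)) ∂(fwdPathLaw ν₀ κF)) /
          (∫ ε, Real.exp (-W ε) ∂(fwdPathLaw ν₀ κF)) ^ 2 - 1) / (N * ε ^ 2)) := by
  haveI := isProbabilityMeasure_fwdPathLaw ν₀ h0 κF
  have hr := toReal_ratio_pos (ν₀ := ν₀) (ν₁ := ν₁) h0 h1
  refine (measure_mono ?_).trans (h.measure_sampleMean_exp_neg_work_ge_le h0 h1 hL2 hN hε)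
  intro y hy
  simp only [mem_setOf_eq] at hy ⊢
  by_contra hlt
  rw [not_le] at hlt
  have key := abs_neg_log_add_log_lt hr hε hε1 hlt
  have hΔF' : -Real.log (((ν₀ univ)⁻¹ * ν₁ univ).toReal) = ΔF := by
    rw [← hΔF, Real.log_exp, neg_neg]
  rw [hΔF'] at key
  unfold jarzynskiEstimate at hy
  linarith

/-- **The same bound with the numerator written as `1/ESS_F − 1 = E_F[e^{−2(W−ΔF)}] − 1`.** -/
theorem measure_jarzynskiEstimate_sub_ge_le_dissipation [IsFiniteMeasure ν₀] [IsFiniteMeasure ν₁]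
    [IsMarkovKernel κF] [IsMarkovKernel κR] (h0 : ν₀ univ ≠ 0) (h1 : ν₁ univ ≠ 0)
    (h : CrooksPair ν₀ ν₁ κF κR s e W)
    (hL2 : MemLp (fun ε => Real.exp (-W ε)) 2 (fwdPathLaw ν₀ κF)) {ΔF : ℝ}
    (hΔF : Real.exp (-ΔF) = ((ν₀ univ)⁻¹ * ν₁ univ).toReal) {N : ℕ} (hN : 0 < N) {ε : ℝ}
    (hε : 0 < ε) (hε1 : ε < 1) :
    haveI := isProbabilityMeasure_fwdPathLaw ν₀ h0 κF
    (Measure.pi fun _ : Fin N => fwdPathLaw ν₀ κF)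
        {y | -Real.log (1 - ε) ≤ |jarzynskiEstimate (fun ε => Real.exp (-W ε)) y - ΔF|} ≤
      ENNReal.ofReal (((∫ ε, Real.exp (-(2 * (W ε - ΔF))) ∂(fwdPathLaw ν₀ κF)) - 1) /
        (N * ε ^ 2)) := by
  have key : (∫ ε, Real.exp (-(2 * W ε)) ∂(fwdPathLaw ν₀ κF)) /
      (∫ ε, Real.exp (-W ε) ∂(fwdPathLaw ν₀ κF)) ^ 2 =
      ∫ ε, Real.exp (-(2 * (W ε - ΔF))) ∂(fwdPathLaw ν₀ κF) := by
    rw [← inv_div, h.essPop_eq_inv_dissipation h0 h1 hΔF, one_div, inv_inv]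
  rw [← key]
  exact h.measure_jarzynskiEstimate_sub_ge_le h0 h1 hL2 hΔF hN hε hε1

/-- **Sample-size rule**: if `(E_F[e^{−2(W−ΔF)}] − 1)/(N ε²) ≤ δ` (i.e.
`N ≥ (1/ESS_F − 1)/(δ ε²)`), then `P {|ΔF̂_N − ΔF| ≥ −log(1 − ε)} ≤ δ`. -/
theorem measure_jarzynskiEstimate_sub_ge_le_of_le [IsFiniteMeasure ν₀] [IsFiniteMeasure ν₁]
    [IsMarkovKernel κF] [IsMarkovKernel κR] (h0 : ν₀ univ ≠ 0) (h1 : ν₁ univ ≠ 0)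
    (h : CrooksPair ν₀ ν₁ κF κR s e W)
    (hL2 : MemLp (fun ε => Real.exp (-W ε)) 2 (fwdPathLaw ν₀ κF)) {ΔF : ℝ}
    (hΔF : Real.exp (-ΔF) = ((ν₀ univ)⁻¹ * ν₁ univ).toReal) {N : ℕ} (hN : 0 < N) {ε δ : ℝ}
    (hε : 0 < ε) (hε1 : ε < 1)
    (hNδ : ((∫ ε, Real.exp (-(2 * (W ε - ΔF))) ∂(fwdPathLaw ν₀ κF)) - 1) / (N * ε ^ 2) ≤ δ) :
    haveI := isProbabilityMeasure_fwdPathLaw ν₀ h0 κF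
    (Measure.pi fun _ : Fin N => fwdPathLaw ν₀ κF)
        {y | -Real.log (1 - ε) ≤ |jarzynskiEstimate (fun ε => Real.exp (-W ε)) y - ΔF|} ≤
      ENNReal.ofReal δ :=
  (h.measure_jarzynskiEstimate_sub_ge_le_dissipation h0 h1 hL2 hΔF hN hε hε1).trans
    (ENNReal.ofReal_le_ofReal hNδ)

end CrooksPair

end Summit.Ventures.LatticeQCDFlow.Exactness.GeneralNCMC
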